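/-
Copyright (c) 2026 the pub-hodgecm-mathlib formalisation cell (harness21).  Prover seat hodgecm-mathlib-A-p03 (g24); LEAD F0P3a-plan (g9) WORD T8-41 «(F4)–(F8) PEN 1»;
LAYER C, θ̄ = 1 (split with F0P3b-p01 (g6) 06:00:28Z), 2026-09-01.
-/
import Literature.NumberTheory.Automorphic.UnitOrbitalIntegralUnfoldingHK                -- ★ B-p12 (F2): Prop. 5 unfolding
import Literature.NumberTheory.Rogawski1990.UnitOrbitalIntegralInertCountJPosVanishing    -- ★ Prop. 10 at the torus literal + `j > N` vanishing
import Literature.NumberTheory.Rogawski1990.UnitOrbitalIntegralInertReindex              -- ★ `j = 2i + θ̄`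
import Literature.NumberTheory.Rogawski1990.UnitOrbitalIntegralInertValuesTheta          -- ★ F0P3b-p01: bridge to `phiOne`
import HarnessLib

/-!
# LAYER C, `θ̄ = 1`: `#{q ∈ U⧸K : t_π q = q} = Φ′-free value phiOne q N₊ N` — Flicker's Prop. 11 (first half) ∕ Props 12–13 values for the `θ = π` tori

Topic `NumberTheory/Rogawski1990` (road «D-N7-inert», MAP v3 LAYER C); namespace `Literature.NumberTheory.Automorphic.UnitaryGroup`.  THEOREMS ONLY; kernel lane.

For F0P3-p02's torus literal `t = t_θ(a,b,c)` with `θ = ϖ` (`θ̄ = 1`) the fixed-point count of `t` on `U ⧸ K` (`U = U(σ,Φ₃)(K)`, `K = unitaryInt`) — which IS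
`Φ(⟦t⟧, 1_K)` by ★ (L2) and the transport (c) — equals `phiOne q N₊ N` (`N = ord(a − c)`, `N₊ = ord(a + c − 2b)`), assembled from: ★ B-p12's Prop. 5 unfolding
`natCard_fixedPoints_unitaryInt_eq_finsum_flickerU` (sum over `m`), Cor. 9 at the θ-torus (B-p04's `natCard_fixedPoints_flickerTorus_eq_finsum`, taken here as the
hypothesis `hC9` in his announced shape — discharged by `exact` when it lands), ★ Prop. 10 at the torus literal `natCard_cosets_flickerTorus_eq_iTen` (`1 ≤ 2i+1 ≤ N`)
and ★ `natCard_cosets_flickerTorus_eq_zero_of_lt` (`2i+1 > N`), ★ the re-indexing `finsum_comp_two_mul_add_one_eq_finsum_ite`, and ★ F0P3b-p01's bridge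
`finsum_natCast_eq_phiOne` (Σ-identities ★ `sumThetaOne_eq_phiOne`).  Head: **`natCard_fixedPoints_unitaryInt_flickerTorus_eq_phiOne`**.
HONEST LABEL: HC_CM is proved only modulo the printed citations until rung 0 closes; the Cor. 9 instance enters as the hypothesis `hC9` until B-p04's file lands.

## References
* [Flicker1998UnitaryFL] Y. Z. Flicker, *Elementary proof of the fundamental lemma for a unitary group*, Canad. J. Math. 50 (1998), 74–98: Prop. 5 p. 82, Cor. 9 p. 85,
  Prop. 10 pp. 85–86, Props 11–13 pp. 87–94.
* [Rogawski1990] J. D. Rogawski, *Automorphic Representations of Unitary Groups in Three Variables* (1990), §4.9 p. 55.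
-/

set_option autoImplicit false

open scoped MatrixGroups WithZero Valued
open Matrix

namespace Literature.NumberTheory.Automorphic

namespace UnitaryGroup

open Literature.NumberTheory.Automorphic.HermitianLattice (unitaryInt mem_unitaryInt_iff LocalConjDatum)
open Literature.NumberTheory.Rogawski1990.Flicker1998 (iTen phiOne corNineWeight)
open IsLocalRing

variable {K : Type*} [Field K] [Valued K ℤᵐ⁰] {ϖ : K} (σ : K →+* K) {J : Matrix (Fin 3) (Fin 3) K}

section ThetaOne

variable [IsDiscreteValuationRing 𝒪[K]] [Finite (ResidueField 𝒪[K])] [IsAdicComplete (maximalIdeal 𝒪[K]) 𝒪[K]]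

set_option synthInstance.maxHeartbeats 200000 in
-- the `H`-action on `H ⧸ (K^{u_m} ∩ H)` is found through the large subgroup terms of the `U(2,1)` frame (as in ★ (F2))
/-- **LAYER C, `θ̄ = 1`**: for `t = t_ϖ(a,b,c)` (F0P3-p02's literal with `θ = ϖ`, `θ′ = ϖ⁻¹`), `#{q ∈ U⧸K : t q = q} = phiOne q N₊ N` as a rational number
(`N = ord(a−c) ≥ 1`, `N₊ = ord(a+c−2b)`), given Cor. 9 at the θ-torus (`hC9`, B-p04's head) for the radial representatives `r_i = diag(ϖ⁻ⁱ, 1, ϖⁱ)`.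
[cite: Flicker1998UnitaryFL, Prop. 5 p. 82, Cor. 9 p. 85, Prop. 10 pp. 85–86, Prop. 11 p. 87] -/
theorem natCard_fixedPoints_unitaryInt_flickerTorus_eq_phiOne (hJ : J = (StdForm.antidiagonal 3).over K) (hd : LocalConjDatum σ ϖ)
    (hσO : ∀ y : 𝒪[K], (σ.comp 𝒪[K].subtype) y ∈ 𝒪[K]) {y : K} (hy : y * σ y = -2)
    {c : ↥(unitaryGroupOfForm σ J)} (hc : ((c : GL (Fin 3) K) : Matrix (Fin 3) (Fin 3) K) = !![1, 0, 0; 0, -1, 0; 0, 0, 1])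
    (u : ℕ → ↥(unitaryGroupOfForm σ J))
    (hu : ∀ m, ((u m : GL (Fin 3) K) : Matrix (Fin 3) (Fin 3) K) = !![ϖ ^ m, y, (ϖ ^ m)⁻¹; 0, 1, -σ y * (ϖ ^ m)⁻¹; 0, 0, (ϖ ^ m)⁻¹])
    {t : ↥(unitaryGroupOfForm σ J)} {e θ θ' a b cc : K} (h2e : 2 * e = 1) (hθ : θ = ϖ ^ 1) (hθ' : θ' = (ϖ ^ 1)⁻¹)
    (ha : σ a * a = 1) (hb : σ b * b = 1) (hcc : σ cc * cc = 1)
    (hte : ((t : GL (Fin 3) K) : Matrix (Fin 3) (Fin 3) K) = !![e * (a + cc), 0, -(e * (a - cc) * θ); 0, b, 0; -(e * (a - cc) * θ'), 0, e * (a + cc)])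
    (htH : t ∈ Subgroup.centralizer ({c} : Set ↥(unitaryGroupOfForm σ J)))
    (r : ℕ → ↥(unitaryGroupOfForm σ J))
    (hr : ∀ i, ((r i : GL (Fin 3) K) : Matrix (Fin 3) (Fin 3) K) = !![ϖ⁻¹ ^ i, 0, 0; 0, 1, 0; 0, 0, ϖ ^ i])
    (hrH : ∀ i, r i ∈ Subgroup.centralizer ({c} : Set ↥(unitaryGroupOfForm σ J)))
    {N Np : ℕ} (hN : Valued.v (a - cc) = Valued.v (ϖ ^ N)) (hNp : Valued.v (a + cc - 2 * b) = Valued.v (ϖ ^ Np))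
    {q : ℕ} (hq : Nat.card (ResidueField 𝒪[K]) = q ^ 2) (hq1 : 1 < q)
    {a₀ : 𝒪[K]} (ha₀ : IsUnit (((σ.comp 𝒪[K].subtype).codRestrict 𝒪[K] hσO) a₀ - a₀))
    (hfin : {x : ↥(unitaryGroupOfForm σ J) ⧸ unitaryInt σ J | t • x = x}.Finite)
    (hC9 : ∀ m, Nat.card {z : ↥(Subgroup.centralizer ({c} : Set ↥(unitaryGroupOfForm σ J))) ⧸
          ((unitaryInt σ J).map (MulAut.conj (u m)).toMonoidHom).subgroupOf (Subgroup.centralizer ({c} : Set ↥(unitaryGroupOfForm σ J))) |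
        (⟨t, htH⟩ : ↥(Subgroup.centralizer ({c} : Set ↥(unitaryGroupOfForm σ J)))) • z = z} =
      ∑ᶠ i : ℕ, (if 2 * i + 1 = 0 then 1 else (q + 1) * q ^ (2 * i + 1 - 1)) *
        Nat.card {w : ↥(flickerPH σ J c) ⧸ (flickerHK σ J c (u m)).subgroupOf (flickerPH σ J c) //
          ((Quotient.out w : ↥(flickerPH σ J c)) : ↥(unitaryGroupOfForm σ J))⁻¹ * ((r i)⁻¹ * t * r i) * (Quotient.out w : ↥(flickerPH σ J c)) ∈
            flickerHK σ J c (u m)}) :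
    (Nat.card {x : ↥(unitaryGroupOfForm σ J) ⧸ unitaryInt σ J | t • x = x} : ℚ) = phiOne q Np N := by
  -- the count of one summand, as `ℚ`
  set C : ℕ → ℕ → ℕ := fun i m => Nat.card {w : ↥(flickerPH σ J c) ⧸ (flickerHK σ J c (u m)).subgroupOf (flickerPH σ J c) //
      ((Quotient.out w : ↥(flickerPH σ J c)) : ↥(unitaryGroupOfForm σ J))⁻¹ * ((r i)⁻¹ * t * r i) * (Quotient.out w : ↥(flickerPH σ J c)) ∈
        flickerHK σ J c (u m)} with hC
  have hCpos : ∀ i m, 2 * i + 1 ≤ N → (C i m : ℚ) = iTen q (N - (2 * i + 1)) Np m := fun i m hi =>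
    natCard_cosets_flickerTorus_eq_iTen σ hJ hd hσO hy hc (hu m) h2e hθ hθ' ha hb hcc hte htH (hr i) (hrH i) hN hNp (by omega) hi hq ha₀
  have hCbig : ∀ i m, N < 2 * i + 1 → C i m = 0 := fun i m hi =>
    natCard_cosets_flickerTorus_eq_zero_of_lt σ hJ hd hy hc (hu m) h2e hθ' hte htH (hr i) (hrH i) hN hi
  -- the values-abstract `I`
  set I : ℕ → ℕ → ℚ := fun j m => if j ≤ N then iTen q (N - j) Np m else 0 with hI
  have hpos : ∀ j m, 1 ≤ j → j ≤ N → I j m = iTen q (N - j) Np m := fun j m _ hj => by rw [hI]; exact if_pos hj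
  have hbig : ∀ j m, N < j → I j m = 0 := fun j m hj => by rw [hI]; exact if_neg (by omega)
  -- the level-`m` count `A m`
  set A : ℕ → ℕ := fun m => Nat.card {z : ↥(Subgroup.centralizer ({c} : Set ↥(unitaryGroupOfForm σ J))) ⧸
      ((unitaryInt σ J).map (MulAut.conj (u m)).toMonoidHom).subgroupOf (Subgroup.centralizer ({c} : Set ↥(unitaryGroupOfForm σ J))) |
    (⟨t, htH⟩ : ↥(Subgroup.centralizer ({c} : Set ↥(unitaryGroupOfForm σ J)))) • z = z} with hAdef
  have hsuppC : ∀ m, (Function.support fun i : ℕ => (if 2 * i + 1 = 0 then 1 else (q + 1) * q ^ (2 * i + 1 - 1)) * C i m).Finite := by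
    intro m
    refine (Set.finite_Iio N).subset fun i hi => ?_
    by_contra hle
    simp only [Set.mem_Iio, not_lt] at hle
    exact hi (by dsimp only; rw [hCbig i m (by omega), mul_zero])
  have hA : ∀ m, (A m : ℚ) = ∑ᶠ j, (if j % 2 = 1 then corNineWeight q j * I j m else 0) := by
    intro m
    rw [hAdef]; dsimp only
    have hcastC := (Nat.castAddMonoidHom ℚ).map_finsum (hsuppC m)
    simp only [Nat.coe_castAddMonoidHom] at hcastC
    rw [hC9 m]
    change ((∑ᶠ i : ℕ, (if 2 * i + 1 = 0 then 1 else (q + 1) * q ^ (2 * i + 1 - 1)) * C i m : ℕ) : ℚ) = _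
    rw [hcastC, ← Rogawski1990.Flicker1998.finsum_comp_two_mul_add_one_eq_finsum_ite]
    refine finsum_congr fun i => ?_
    rw [Nat.cast_mul, Rogawski1990.Flicker1998.natCast_weight_eq_corNineWeight hq1.le (2 * i + 1)]
    by_cases hi : 2 * i + 1 ≤ N
    · rw [hpos _ m (by omega) hi, ← hCpos i m hi]
    · rw [hbig _ m (by omega), hCbig i m (by omega), Nat.cast_zero]
  have hsuppA : (Function.support A).Finite := by
    refine (finite_setOf_nonempty_fixedPoints_flickerU σ hJ hd hy hc u hu htH hfin).1.subset fun m hm => ?_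
    by_contra hne
    apply hm
    rw [hAdef]; dsimp only
    simp only [Set.mem_setOf_eq, not_nonempty_iff] at hne
    exact @Nat.card_of_isEmpty _ hne
  have hcast := (Nat.castAddMonoidHom ℚ).map_finsum hsuppA
  simp only [Nat.coe_castAddMonoidHom] at hcast
  rw [natCard_fixedPoints_unitaryInt_eq_finsum_flickerU σ hJ hd hy hc u hu htH hfin]
  change ((∑ᶠ m, A m : ℕ) : ℚ) = _
  rw [hcast]
  exact Rogawski1990.Flicker1998.finsum_natCast_eq_phiOne q I hpos hbig hq1 A hA

end ThetaOne

end UnitaryGroup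

end Literature.NumberTheory.Automorphic
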